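import Literature.NumberTheory.ComplexMultiplication.TaniyamaElementUpToSigns
import HarnessLib

/-!
# «σ fixes `E*` if and only if `σΦ = Φ`»: the stabiliser in `Γ_ℚ` of a CM type `Ψ ⊆ Γ_ℚ ⧸ res(Γ_K)` is `res(Γ_{E*})`
# (Milne, *The fundamental theorem of complex multiplication*, arXiv:0705.3446, §4.2 and §4.3, proof of Proposition 4.14)

Topic `NumberTheory/ComplexMultiplication`; namespace `Literature.NumberTheory.ComplexMultiplication`.  Lane
`lit-hodgefound` (Track 2, Layer A3 skeleton seat `skel-3`, row A3-G48 FILE 2 of 2 — the rider of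
`…/TaniyamaElementUpToSigns` (FILE 1: Props. 4.13, 4.14, Cor. 4.15 for an axiomatised `g_Φ`)).  THEOREMS ONLY, all proved;
no definition, no named fact, no instance (D-0026, net debt 0).

## The print, verbatim

J. S. Milne, *The fundamental theorem of complex multiplication*, arXiv:0705.3446 [Milne2007FundamentalCM], §4.2 (held
`paper:arxiv-0705.3446` p0020 L38–L42) and §4.3 (p0021 L104–L107, L116–L120):

> «Let `E*` be the reflex field for `(E,Φ)`, so that `Aut(ℂ/E*) = {σ ∈ Aut(ℂ) | σΦ = Φ}`. Then `Φ Aut(ℂ/E) = ⋃_{φ∈Φ} φ·Aut(ℂ/E)`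
> is stable under the left action of `Aut(ℂ/E*)` […]»
> «The condition `σΦ = Φ` in (e) means that `σ` fixes the reflex field of `(E, Φ)` […]»
> «PROOF [of Prop. 4.14]. Recall that `σ` fixes `E*` if and only if `σΦ = Φ`, in which case (4.13e) shows that
> `e_Φ(σ) = 1`. Replacing `τ` by `σ⁻¹τ` in (a), we find that `e_Φ(τ) = e_Φ(σ)` if `τΦ = σΦ`, i.e., `e_Φ(σ)` depends only on
> the restriction of `σ` to the reflex field of `(E, Φ)`.»

with Shimura's description of the reflex field `E* = ℚ(∑_{φ∈Φ} φ(x) | x ∈ E) ⊂ ℂ` (G. Shimura, *Abelian varieties with complex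
multiplication and modular functions* (1998), §8.3 Prop. 28, last assertion — the tree's `traceField Φ`, `…/ComplexReflexField`).

## Setting (rows A3-G45 – A3-G48)

`K` a number field, `Φ : CMType K` a complex CM type, `X = Γ_ℚ ⧸ H`, `H = res(Γ_K)`; along an embedding `j : ℚ̄ → ℂ` the coset
space is `Hom(K, ℂ)` (`embOfCoset K j : gH ↦ j ∘ g ∘ e`, row A3-G45 `…/TateHalfTransferCM`) and `Φ` is read on `X` as
`Ψ = embOfCoset K j ⁻¹' Φ`.  A number field `k ⊂ ℂ` (`k : IntermediateField ℚ ℂ`) is COMPATIBLE with `j` when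
`j ∘ e_{ℚ,k} = (k ⊂ ℂ)` (`hj`, as in row A3-G46), so that `res(Γ_k) ≤ Γ_ℚ` is «`Aut(ℂ/k)`».  Row A3-G46 FILE 4 proved
«`Φ Aut(ℂ/E)` is stable under `Aut(ℂ/E*)`»: `res(Γ_k) • Ψ = Ψ` for `k ⊇ E* = traceField Φ`
(`absGaloisRestrict_smul_preimage_cmType`).  This file proves the CONVERSE inclusion and the resulting equality.

## What is proved

* §1 the type trace lifted to `ℚ̄`: `tr_Φ(x) = ∑_{φ∈Φ} φ(x) = j(∑_{q∈Ψ} w_q e(x))` for any representatives `w_q` of the cosets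
  `q ∈ Ψ` (`cmTypeTrace_eq_apply_sum`), and `σ(∑_{q∈Ψ} w_q e(x)) = ∑_{q∈Ψ} w_q e(x)` when `σΨ = Ψ` («`σ` permutes `Φ`»,
  `smul_sum_out_smul_absEmbedding`); hence every element of `E* = ℚ(tr_Φ(E))` is `j` of a `σ`-fixed element of `ℚ̄`
  (`exists_smul_eq_and_apply_eq_of_mem_traceField`, induction on `IntermediateField.adjoin`).
* §2 **`σΨ = Ψ ⇒ σ ∈ res(Γ_k)` for every compatible `k ⊆ E*`** (`mem_range_absGaloisRestrict_of_smul_preimage_cmType_eq`),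
  whence for `k = E*`: **`σΨ = Ψ ↔ σ ∈ res(Γ_{E*})`** (`smul_preimage_cmType_eq_iff_mem_range`), the stabiliser
  `Stab_{Γ_ℚ}(Ψ) = res(Γ_{E*})` (`stabilizer_preimage_cmType_eq_range`) — «`Aut(ℂ/E*) = {σ | σΦ = Φ}`» —, and
  `τΨ = σΨ ↔ σ⁻¹τ ∈ res(Γ_{E*})` («depends only on the effect of `σ` on `E*`»).
* §3 the readings of Prop. 4.13 (e) / Prop. 4.14 on `Γ_{E*}` for a Taniyama defect `e` (`K` CM, `c` a complex conjugation
  with `j(c•y) = \overline{j y}`): `e_Ψ(res τ) = 1` for `τ ∈ Γ_k`, `k ⊇ E*` (`IsTaniyamaDefect.apply_absGaloisRestrict`);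
  `e_Ψ(τ) = e_Ψ(σ)` if `σ⁻¹τ ∈ res(Γ_k)` (`IsTaniyamaDefect.apply_eq_of_inv_mul_mem_range`); and the junction for Layer B's
  input: a family `g` agreeing with the Taniyama element on `res(Γ_{E*})` agrees with it on the whole stabiliser
  (`eq_of_smul_preimage_cmType_eq_of_forall_absGaloisRestrict`) — the hypothesis (e) of FILE 1's
  `isTaniyamaDefect_div_taniyamaElement` in the form in which Thm. 3.10 / Prop. 4.9 deliver it.

NOT HERE: the existence of a compatible pair `(j, c)` for a given `k ⊂ ℂ` (row A3-G46 FILE 5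
`exists_embedding_isComplexConjugation`); `NumberField (traceField Φ)` as an instance (users supply `k = E*` with its own
instance).

## References

* J. S. Milne, *The fundamental theorem of complex multiplication*, arXiv:0705.3446 (2007), §4.2 (before Prop. 4.9), §4.3
  Prop. 4.13 (e), Prop. 4.14 (proof). [Milne2007FundamentalCM]
* G. Shimura, *Abelian varieties with complex multiplication and modular functions*, Princeton (1998), §8.3 Prop. 28. [Shimura1998]
* J. S. Milne, *Fields and Galois Theory* (v5.10, 2022), Ch. 7 (the absolute Galois group; `Gal(Ω/E)` as a stabiliser). [MilneFT2022]

## Provenance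

Lane `lit-hodgefound`, seat `literature-prover-lit-hodgefound-skel-3-g32-0` (row A3-G48, FILE 2 of 2).
-/

noncomputable section

open scoped Pointwise
open Field NumberField IsDedekindDomain

namespace Literature.NumberTheory.ComplexMultiplication

open Literature.NumberTheory.GaloisRepresentations Literature.NumberTheory.NumberFields
open Literature.AlgebraicGeometry.Motives (CMType)
open HalfTransfer

/-! ### §1. The type trace lifted to `ℚ̄` and its invariance under the stabiliser of `Ψ` -/

section Trace

variable (K : Type) [Field K] [NumberField K] (j : AlgebraicClosure ℚ →+* ℂ)

/-- `Θ(q)(x) = j(w_q • e x)` for the representative `w_q = q.out` of the coset `q`.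
[cite: Milne2007FundamentalCM, §4.2 («choose elements w_ρ ∈ Aut(ℂ), one for each ρ ∈ Hom(E, ℂ), such that w_ρ|E = ρ»)] -/
theorem embOfCoset_eq_out_smul (q : absoluteGaloisGroup ℚ ⧸ (absGaloisRestrict ℚ K).range) (x : K) :
    embOfCoset K j q x = j (q.out • (absEmbedding ℚ K x : AlgebraicClosure ℚ)) := by
  have h : embOfCoset K j q =
      embOfCoset K j ((q.out : absoluteGaloisGroup ℚ) : absoluteGaloisGroup ℚ ⧸ (absGaloisRestrict ℚ K).range) := by
    rw [QuotientGroup.out_eq']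
  rw [h, embOfCoset_mk, embOfElement_apply]

/-- Two elements of the same coset of `res(Γ_K)` agree on `e(K)` (`res(Γ_K)` is the pointwise stabiliser of `e(K)`,
`mem_range_absGaloisRestrict_iff_smul_absEmbedding`). [cite: MilneFT2022, Ch. 7 (Gal(Ω/E) = {σ | σ|E = id})] -/
theorem smul_absEmbedding_eq_of_coe_eq {g g' : absoluteGaloisGroup ℚ}
    (h : (g : absoluteGaloisGroup ℚ ⧸ (absGaloisRestrict ℚ K).range) = g') (x : K) :
    g • (absEmbedding ℚ K x : AlgebraicClosure ℚ) = g' • absEmbedding ℚ K x := by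
  rw [QuotientGroup.eq] at h
  have hx := (mem_range_absGaloisRestrict_iff_smul_absEmbedding ℚ K (g⁻¹ * g')).mp h x
  rw [mul_smul, inv_smul_eq_iff] at hx
  exact hx.symm

variable (Φ : CMType K)

/-- **The type trace through `j`: `tr_Φ(x) = ∑_{φ∈Φ} φ(x) = j(∑_{q∈Ψ} w_q • e x)`**, `Ψ = Θ⁻¹(Φ)` (reindex along the bijection
`Θ = embOfCoset K j : X ≃ Hom(K, ℂ)`). [cite: Shimura1998, §8.3 Prop. 28 («K* = Q(∑ᵢ ξ^{φᵢ} | ξ ∈ F)»)] [cite: Milne2007FundamentalCM, §4.2] -/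
theorem cmTypeTrace_eq_apply_sum (x : K) :
    cmTypeTrace Φ x = j (∑ q ∈ (embOfCoset K j ⁻¹' Φ.1).toFinite.toFinset,
      q.out • (absEmbedding ℚ K x : AlgebraicClosure ℚ)) := by
  rw [map_sum, cmTypeTrace_apply]
  symm
  refine Finset.sum_equiv (cosetEquivEmb K j) (fun q => ?_) (fun q _ => ?_)
  · rw [Set.Finite.mem_toFinset, Set.Finite.mem_toFinset, Set.mem_preimage, cosetEquivEmb_apply]
  · rw [cosetEquivEmb_apply, embOfCoset_eq_out_smul]

/-- **«`σ` permutes `Φ`»: if `σΨ = Ψ` then `σ` fixes `∑_{q∈Ψ} w_q • e x`** (`σ w_q` represents the coset `σq ∈ Ψ`, and the value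
`w • e x` depends only on the coset of `w`). [cite: Milne2007FundamentalCM, §4.2 («stable under the left action of Aut(ℂ/E*)»), §4.3 Prop. 4.13 (e)] -/
theorem smul_sum_out_smul_absEmbedding {σ : absoluteGaloisGroup ℚ}
    (hσ : σ • (embOfCoset K j ⁻¹' Φ.1) = embOfCoset K j ⁻¹' Φ.1) (x : K) :
    σ • (∑ q ∈ (embOfCoset K j ⁻¹' Φ.1).toFinite.toFinset, q.out • (absEmbedding ℚ K x : AlgebraicClosure ℚ)) =
      ∑ q ∈ (embOfCoset K j ⁻¹' Φ.1).toFinite.toFinset, q.out • (absEmbedding ℚ K x : AlgebraicClosure ℚ) := by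
  rw [Finset.smul_sum]
  have hterm : ∀ q : absoluteGaloisGroup ℚ ⧸ (absGaloisRestrict ℚ K).range,
      σ • q.out • (absEmbedding ℚ K x : AlgebraicClosure ℚ) = (σ • q).out • absEmbedding ℚ K x := fun q => by
    rw [← mul_smul]
    refine smul_absEmbedding_eq_of_coe_eq K ?_ x
    have h1 : ((σ * q.out : absoluteGaloisGroup ℚ) : absoluteGaloisGroup ℚ ⧸ (absGaloisRestrict ℚ K).range) = σ • q := by
      rw [← smul_eq_mul, ← MulAction.Quotient.smul_coe, QuotientGroup.out_eq']
    rw [h1, QuotientGroup.out_eq']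
  simp_rw [hterm]
  refine Finset.sum_equiv (MulAction.toPerm σ) (fun q => ?_) (fun q _ => rfl)
  rw [Set.Finite.mem_toFinset, Set.Finite.mem_toFinset, MulAction.toPerm_apply]
  conv_rhs => rw [← hσ]
  exact Set.smul_mem_smul_set_iff.symm

/-- **Every element of `E* = ℚ(tr_Φ(E))` is `j` of a `σ`-fixed element of `ℚ̄`, when `σΨ = Ψ`** (the `σ`-fixed elements form a
subfield and the type traces lie in its image). [cite: Milne2007FundamentalCM, §4.3 Prop. 4.13 («the condition σΦ = Φ in (e) means that σ fixes the reflex field»)] [cite: Shimura1998, §8.3 Prop. 28] -/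
theorem exists_smul_eq_and_apply_eq_of_mem_traceField {σ : absoluteGaloisGroup ℚ}
    (hσ : σ • (embOfCoset K j ⁻¹' Φ.1) = embOfCoset K j ⁻¹' Φ.1) {z : ℂ} (hz : z ∈ traceField Φ) :
    ∃ y : AlgebraicClosure ℚ, σ • y = y ∧ j y = z := by
  have hz' : z ∈ IntermediateField.adjoin ℚ (Set.range (cmTypeTrace Φ)) := hz
  clear hz
  induction hz' using IntermediateField.adjoin_induction with
  | mem z hz =>
    obtain ⟨x, rfl⟩ := hz
    exact ⟨_, smul_sum_out_smul_absEmbedding K j Φ hσ x, (cmTypeTrace_eq_apply_sum K j Φ x).symm⟩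
  | algebraMap r =>
    refine ⟨(r : AlgebraicClosure ℚ), ?_, ?_⟩
    · rw [absoluteGaloisGroup.smul_def, map_ratCast]
    · rw [map_ratCast, eq_ratCast]
  | add z w _ _ ihz ihw =>
    obtain ⟨y, hy, rfl⟩ := ihz
    obtain ⟨y', hy', rfl⟩ := ihw
    exact ⟨y + y', by rw [smul_add, hy, hy'], map_add j y y'⟩
  | inv z _ ih =>
    obtain ⟨y, hy, rfl⟩ := ih
    exact ⟨y⁻¹, by rw [smul_inv'', hy], map_inv₀ j y⟩
  | mul z w _ _ ihz ihw =>
    obtain ⟨y, hy, rfl⟩ := ihz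
    obtain ⟨y', hy', rfl⟩ := ihw
    exact ⟨y * y', by rw [smul_mul', hy, hy'], map_mul j y y'⟩

end Trace

/-! ### §2. `σΨ = Ψ ↔ σ ∈ res(Γ_{E*})` -/

section Stabiliser

variable (K : Type) [Field K] [NumberField K] (Φ : CMType K) (k : IntermediateField ℚ ℂ) [NumberField k]
  {j : AlgebraicClosure ℚ →+* ℂ} (hj : ∀ x : k, j (absEmbedding ℚ k x) = (x : ℂ))
include hj

/-- **`σΨ = Ψ ⇒ σ ∈ res(Γ_k)` for every `k ⊆ E*` compatible with `j`** — the converse of row A3-G46's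
`absGaloisRestrict_smul_preimage_cmType`: `σ` fixes `e_{ℚ,k}(x)` for every `x ∈ k` (by §1, `j(e(x)) = x ∈ E*` is `j` of a
`σ`-fixed element, and `j` is injective), i.e. `σ ∈ Gal(ℚ̄/e(k)) = res(Γ_k)`. [cite: Milne2007FundamentalCM, §4.2 («Aut(ℂ/E*) = {σ ∈ Aut(ℂ) | σΦ = Φ}»), §4.3 Prop. 4.14 (proof)] -/
theorem mem_range_absGaloisRestrict_of_smul_preimage_cmType_eq (hk : k ≤ traceField Φ) {σ : absoluteGaloisGroup ℚ}
    (hσ : σ • (embOfCoset K j ⁻¹' Φ.1) = embOfCoset K j ⁻¹' Φ.1) : σ ∈ (absGaloisRestrict ℚ k).range := by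
  rw [mem_range_absGaloisRestrict_iff_smul_absEmbedding]
  intro x
  obtain ⟨y, hy, hyx⟩ := exists_smul_eq_and_apply_eq_of_mem_traceField K j Φ hσ (hk x.2)
  have hye : y = absEmbedding ℚ k x := j.injective (by rw [hyx, hj])
  rw [← hye, hy]

/-- **«`Aut(ℂ/E*) = {σ ∈ Aut(ℂ) | σΦ = Φ}`»: `σΨ = Ψ ↔ σ ∈ res(Γ_{E*})`** for `k = E*` (i.e. `traceField Φ ≤ k ≤ traceField Φ`)
compatible with `j`. [cite: Milne2007FundamentalCM, §4.2, §4.3 Prop. 4.14 (proof: «σ fixes E* if and only if σΦ = Φ»)] -/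
theorem smul_preimage_cmType_eq_iff_mem_range (hk : traceField Φ ≤ k) (hk' : k ≤ traceField Φ) (σ : absoluteGaloisGroup ℚ) :
    σ • (embOfCoset K j ⁻¹' Φ.1) = embOfCoset K j ⁻¹' Φ.1 ↔ σ ∈ (absGaloisRestrict ℚ k).range := by
  refine ⟨mem_range_absGaloisRestrict_of_smul_preimage_cmType_eq K Φ k hj hk', ?_⟩
  rintro ⟨δ, rfl⟩
  exact absGaloisRestrict_smul_preimage_cmType k hj K Φ hk δ

/-- The stabiliser of `Ψ` in `Γ_ℚ` is `res(Γ_{E*})`. [cite: Milne2007FundamentalCM, §4.2 («Aut(ℂ/E*) = {σ ∈ Aut(ℂ) | σΦ = Φ}»)] -/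
theorem stabilizer_preimage_cmType_eq_range (hk : traceField Φ ≤ k) (hk' : k ≤ traceField Φ) :
    MulAction.stabilizer (absoluteGaloisGroup ℚ) (embOfCoset K j ⁻¹' Φ.1) = (absGaloisRestrict ℚ k).range := by
  ext σ
  rw [MulAction.mem_stabilizer_iff, smul_preimage_cmType_eq_iff_mem_range K Φ k hj hk hk']

/-- **«depends only on the effect of `σ` on `E*`»: `τΨ = σΨ ↔ σ⁻¹τ ∈ res(Γ_{E*})`.** [cite: Milne2007FundamentalCM, §4.3 Prop. 4.14 (proof)] -/
theorem smul_preimage_cmType_eq_smul_iff (hk : traceField Φ ≤ k) (hk' : k ≤ traceField Φ) (σ τ : absoluteGaloisGroup ℚ) :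
    τ • (embOfCoset K j ⁻¹' Φ.1) = σ • (embOfCoset K j ⁻¹' Φ.1) ↔ σ⁻¹ * τ ∈ (absGaloisRestrict ℚ k).range := by
  rw [← smul_preimage_cmType_eq_iff_mem_range K Φ k hj hk hk', mul_smul, inv_smul_eq_iff]

/-- One direction for every `k ⊇ E*`: `σ⁻¹τ ∈ res(Γ_k) ⇒ τΨ = σΨ`. [cite: Milne2007FundamentalCM, §4.3 Prop. 4.14 (proof)] -/
theorem smul_preimage_cmType_eq_smul_of_inv_mul_mem_range (hk : traceField Φ ≤ k) {σ τ : absoluteGaloisGroup ℚ}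
    (h : σ⁻¹ * τ ∈ (absGaloisRestrict ℚ k).range) :
    τ • (embOfCoset K j ⁻¹' Φ.1) = σ • (embOfCoset K j ⁻¹' Φ.1) := by
  obtain ⟨δ, hδ⟩ := h
  have hδ' : absGaloisRestrict ℚ k δ = σ⁻¹ * τ := hδ
  rw [← mul_inv_cancel_left σ τ, mul_smul, ← hδ', absGaloisRestrict_smul_preimage_cmType k hj K Φ hk δ]

end Stabiliser

/-! ### §3. Proposition 4.13 (e) and Proposition 4.14 read on `Γ_{E*}` -/

section Defect

variable (K : Type) [Field K] [NumberField K] [IsCMField K] (Φ : CMType K) (k : IntermediateField ℚ ℂ) [NumberField k]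
  {j : AlgebraicClosure ℚ →+* ℂ} (hj : ∀ x : k, j (absEmbedding ℚ k x) = (x : ℂ))
  {υ : ℚ →+* ℝ} {c : absoluteGaloisGroup ℚ} (hc : IsComplexConjugation υ c)
  (hjc : ∀ y : AlgebraicClosure ℚ, j (c • y) = starRingEnd ℂ (j y))
  {e : Set (absoluteGaloisGroup ℚ ⧸ (absGaloisRestrict ℚ K).range) → absoluteGaloisGroup ℚ →
    (FiniteAdeleRing (𝓞 K) K)ˣ ⧸ (FiniteAdeleRing.unitEmbedding (𝓞 K) K).range}

include hj hc hjc in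
/-- **PROP. 4.13 (e) / 4.14 «is `1` if `σ|E* = id`» on `Γ_k`, `k ⊇ E*`**: `e_Ψ(res τ) = 1` for every `τ ∈ Γ_k`.
[cite: Milne2007FundamentalCM, §4.3 Prop. 4.13 (e), Prop. 4.14] -/
theorem IsTaniyamaDefect.apply_absGaloisRestrict (he : IsTaniyamaDefect K c e) (hk : traceField Φ ≤ k)
    (τ : absoluteGaloisGroup k) : e (embOfCoset K j ⁻¹' Φ.1) (absGaloisRestrict ℚ k τ) = 1 :=
  he.apply_eq_one (isCMTypeWith_preimage_cmType K hc hjc Φ) (absGaloisRestrict_smul_preimage_cmType k hj K Φ hk τ)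

include hj hc hjc in
/-- **PROP. 4.14 «`e_Φ(σ)` depends only on the effect of `σ` on `E*`»**: `e_Ψ(τ) = e_Ψ(σ)` whenever `σ⁻¹τ ∈ res(Γ_k)`, `k ⊇ E*`.
[cite: Milne2007FundamentalCM, §4.3 Prop. 4.14] -/
theorem IsTaniyamaDefect.apply_eq_of_inv_mul_mem_range (he : IsTaniyamaDefect K c e) (hk : traceField Φ ≤ k)
    {σ τ : absoluteGaloisGroup ℚ} (h : σ⁻¹ * τ ∈ (absGaloisRestrict ℚ k).range) :
    e (embOfCoset K j ⁻¹' Φ.1) τ = e (embOfCoset K j ⁻¹' Φ.1) σ :=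
  he.eq_of_smul_set_eq (isCMTypeWith_preimage_cmType K hc hjc Φ)
    (smul_preimage_cmType_eq_smul_of_inv_mul_mem_range K Φ k hj hk h)

include hj in
omit [IsCMField K] in
/-- **The junction for hypothesis (e) of FILE 1**: a family `g` that agrees with the Taniyama element on `res(Γ_{E*})` (the form
in which the fundamental theorem over the reflex field, Thm. 3.10, and Prop. 4.9 deliver it) agrees with it at every `σ` with
`σΨ = Ψ`. [cite: Milne2007FundamentalCM, §4.3 Prop. 4.13 (e) (proof: «the fundamental theorem is known to hold in that case, which means that f_Φ(σ) = g_Φ(σ)»)] -/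
theorem eq_of_smul_preimage_cmType_eq_of_forall_absGaloisRestrict (hk' : k ≤ traceField Φ)
    {g f : Set (absoluteGaloisGroup ℚ ⧸ (absGaloisRestrict ℚ K).range) → absoluteGaloisGroup ℚ →
      (FiniteAdeleRing (𝓞 K) K)ˣ ⧸ (FiniteAdeleRing.unitEmbedding (𝓞 K) K).range}
    (hg : ∀ τ : absoluteGaloisGroup k,
      g (embOfCoset K j ⁻¹' Φ.1) (absGaloisRestrict ℚ k τ) = f (embOfCoset K j ⁻¹' Φ.1) (absGaloisRestrict ℚ k τ))
    {σ : absoluteGaloisGroup ℚ} (hσ : σ • (embOfCoset K j ⁻¹' Φ.1) = embOfCoset K j ⁻¹' Φ.1) :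
    g (embOfCoset K j ⁻¹' Φ.1) σ = f (embOfCoset K j ⁻¹' Φ.1) σ := by
  obtain ⟨τ, rfl⟩ := mem_range_absGaloisRestrict_of_smul_preimage_cmType_eq K Φ k hj hk' hσ
  exact hg τ

end Defect

end Literature.NumberTheory.ComplexMultiplication

end
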